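import Summits.CriticalPhenomena.Ising3DConformalLimit.Theses.IsingEuclidUpgrade
import Literature.Probability.LatticeModels.CriticalUrsellFourSign
import Literature.Probability.LatticeModels.PointwiseScalingLimitScale
import Literature.Probability.LatticeModels.GeneralisedFreeFamily
import Literature.Probability.LatticeModels.CriticalWickDichotomy
import Literature.Probability.LatticeModels.CriticalWickIff
import Literature.Probability.LatticeModels.PointwiseScalingLimitSelfSimilar
import Literature.Probability.LatticeModels.PointwiseScalingLimitScaleCovariant

/-!
# Disproof of `IsingEuclidUpgradeR4NonGaussian` (stmt-CriticalPhenomena-0636) — findings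

Crux (shared by the routes IsingEuclidUpgrade / HyperoctahedralRP / IsingCFTData /
LinkingParityCircles, verbatim):
`∀ ρ S, (∀ δ ∈ Ioc 0 1, 0 < ρ δ) → HasPointwiseScalingLimit (criticalCorr 3) ρ S →
  IsNondegenerateTwoPoint S → HasNontrivialU4 S`.

**VERDICT (cdisprove gen 2): NOT REFUTED — the statement resists.** A refutation must EXHIBIT a
non-degenerate pointwise scaling limit of the critical nearest-neighbour Ising correlators on `ℤ³`
(full filter `δ → 0⁺`, all `n`, locally uniformly) whose connected four-point function vanishes off the
diagonals; by §B below such a limit is then the full Wick (Gaussian) family of its own two-point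
function (`not_hasNontrivialU4_iff_gaussian`), i.e. the negation of the crux is EXACTLY "the critical
Ising₃ scaling limit exists and is Gaussian" — the famous open non-triviality problem below the upper
critical dimension (Aizenman 1982 §1; Aizenman–Duminil-Copin 2021 Thm 1.2 settles `d = 4` as
GAUSSIAN; Panis 2023, arXiv:2309.05797 §1 p. 4 footnote, read: "non-triviality of the nearest-neighbour
Ising model has been proven for `d=2` in [A], while the case `d=3` remains open … the recent conformal
bootstrap approach … strongly supports this conjecture"; Duminil-Copin ICM 2022 §6.4/§8.4).
No junk route exists: the typing is clean (§A: every hypothesis is either load-bearing with an explicit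
Lean witness, or provably cosmetic).

## Index (all `theorem`s sorry-free; no near-miss left open in Lean — the residue is the open problem itself)
* §A.0 TYPING AUDIT: `criticalCorr_is_boxLimit` (no `limUnder` junk: genuine box limit for free/plus/minus
  b.c.), `criticalCorr_apriori` (`|·| ≤ 1`, odd orders vanish, Lebowitz), `criticalCorr_two_pos` (§C.4).
* §A LOAD-BEARING ANALYSIS
  - `false_without_nondegeneracy` — drop `IsNondegenerateTwoPoint`: FALSE (ρ δ = δ kills every
    correlator; the zero family IS a pointwise limit of `criticalCorr 3`).
  - `false_without_latticeClause`, `false_without_latticeClause_moebius` — drop the lattice clause: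
    FALSE even for Möbius-covariant non-degenerate `S` (generalised free field, tree file
    `GeneralisedFreeFamily`): non-triviality is NOT a consequence of any symmetry/positivity list.
  - `iff_withoutPositivity` — the hypothesis `0 < ρ` on `(0,1]` is COSMETIC: the crux is equivalent
    to the version with NO condition on `ρ` (odd correlators vanish, `m*(β_c)=0`; a limit with `S₂>0`
    forces `ρ ≠ 0` eventually; `exists_pos_renormalisation`).
* §B STRUCTURE every proof / refutation must respect (for EVERY pointwise limit, any `ρ`)
  - `U4_nonpos` (Lebowitz: `U₄^S ≤ 0`), `iff_exists_neg` (crux ⇔ `∃ x, U₄^S x < 0`),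
    `abs_U4_le_two_mul` (`|U₄^S(x)| ≤ 2 S₂(x₀,x₁)S₂(x₂,x₃)`: the intersection probability
    `p(x) := -U₄^S(x)/(2S₂S₂) ∈ [0,1]`), §B.3′ GKS floor `two_mul_two_le_four` / `U4_sandwich`
    (`-cross ≤ U₄^S ≤ 0`, the "pinned sandwich"), `iff_exists_form` (limits are unique up to `c^n`: the ∀-crux
    ⇔ its ∃-form, given existence); §B.5 Gaussian dichotomy (`not_hasNontrivialU4_iff_gaussian`,
    `iff_nonGaussian`, `hasNontrivialU4_of_ne_wick`, `U4_eq_sub_pairingSum`; tree files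
    `CriticalWickDichotomy` p69474 + `CriticalWickIff`, both from this seat): ¬crux-conclusion ⇔ full
    Wick family at ALL even orders;
    §B.6 scale covariance is AUTOMATIC with some `Δ ∈ [1/2,1]` and `ρ` is regularly varying of index
    `-Δ` (`exists_scale_covariance`, `U4_smul`, `renormalisation_regularly_varying`; tree file
    `PointwiseScalingLimitScaleCovariant` from this seat, p70600/p71137).
* §C ρ-FREE LATTICE TARGET: `LatticeU4RatioPositive` (one configuration, one `c > 0`:
  `-U₄^{lat}([x/δ]) ≥ c⟨σσ⟩⟨σσ⟩([x/δ])` for small `δ`) — `of_latticeU4RatioPositive` (sufficient,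
  unconditionally), `latticeU4RatioPositive_of` (necessary, given a non-degenerate limit),
  `LatticeU4RatioPositiveSeq` / `of_latticeU4RatioPositiveSeq` (the same along ONE sequence of meshes
  suffices — weakest sufficient lattice input); §C.4/§C.5 the
  SAME target in random-current language through the PROVED box identity ADC21 (3.11)
  (`connectedFour_free_box_eq`): `CurrentsIntersectUniformly` (box double-current clusters of
  `{[x₀/δ],[x₁/δ]}` and `{[x₂/δ],[x₃/δ]}` meet with probability `≥ c`, all small `δ`, all large boxes);
  `of_currentsIntersect : CurrentsIntersectUniformly → Crux`, `currentsIntersect_of` (converse given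
  existence), `iff_currentsIntersect_of_exists` — Aizenman's 1982 criterion as a two-sided equivalence.
* §D DIMENSION SHARPNESS: `cruxAt_iff_vacuous_of_five_le` — the same statement on `ℤ^d`, `d ≥ 5`, holds
  iff NO non-degenerate limit exists (tree theorem `limitConnectedFour_eq_zero_of_hasPointwiseScalingLimit_holds`):
  any proof for `d = 3` must use `d < 4` (the tree-diagram count `L^{4-d-2η}`), not only RP/GKS/Lebowitz.
* §E WEAK NON-DEGENERACY: `iff_weakNondegeneracy` — non-degeneracy at ONE pair is equivalent (gen-1's
  near-miss CLOSED via self-similarity of full-filter limits; tree file `PointwiseScalingLimitSelfSimilar`,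
  LANDED p69885 from this seat); `two_pos_everywhere_or_nowhere`.
  OPEN REDUCTIONS (prose, §E.2/§E.2′): `η = 0` + OS axioms ⇒ Gaussian (Jost–Schroer–Pohlmeyer) — so the
  crux for an OS-positive limit forces `η > 0`, itself open on `ℤ³`; for `η > 0` locality (a stress
  tensor) separates Ising₃ from the Gaussian scenario (`gff_no_stress_tensor_arith`). §E.3: CENSUS of
  what a refutation would have to be (all clauses proved above). §E.4: strengthening REFUTED —
  continuity of pointwise limits is not automatic (`exists_discontinuous_pointwiseScalingLimit`).
* §F NUMERICS: torus Swendsen–Wang jobs `j007216` (d=3) / `j007217` (d=2,4,5 controls) of the statistic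
  `p(h,L) = -U₄/(2S₂S₂)` (queued; readout rule and published values in §F).

Conventions: `Crux` abbreviates the route decl; `d = 3` throughout except §D.
-/

noncomputable section

namespace Summit.CriticalPhenomena.Ising3DConformalLimit.Cruxes.IsingEuclidUpgradeR4NonGaussian.Disproof

open Literature.Probability.LatticeModels Literature.Probability.Percolation Filter Set MeasureTheory
open scoped Topology symmDiff

/-- The crux, by name. -/
abbrev Crux : Prop :=
  Summit.CriticalPhenomena.Ising3DConformalLimit.Theses.IsingEuclidUpgrade.IsingEuclidUpgradeR4NonGaussian

/-- Unfolding of the crux (definitional). -/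
theorem crux_iff : Crux ↔ ∀ (ρ : ℝ → ℝ) (S : CorrFamily 3), (∀ δ ∈ Set.Ioc (0:ℝ) 1, 0 < ρ δ) →
    HasPointwiseScalingLimit (criticalCorr 3) ρ S → IsNondegenerateTwoPoint S → HasNontrivialU4 S :=
  Iff.rfl

/-! ## §A.0 Typing audit: the lattice object is junk-free (so no refutation "for the wrong reason") -/

/-- `criticalCorr 3 n y` (defined through `limUnder` of plus-boundary boxes) IS the thermodynamic
limit: the box expectations converge to it for every boundary condition in `{free, plus, minus}`
(tree theorem `criticalCorr_wellDefined_holds`, `d ≥ 3`, using `m*(β_c) = 0`). Hence no `limUnder`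
junk value enters the crux. [cite: FriedliVelenik2017, Thm. 3.17 and Lemma 3.23] -/
theorem criticalCorr_is_boxLimit (n : ℕ) (y : Fin n → Site 3) (bc : BoundaryCondition (Site 3))
    (hbc : bc ∈ ({.free, .plus, .minus} : Set (BoundaryCondition (Site 3)))) :
    Tendsto (fun L : ℕ => isingExpect (zdGraph 3) (box 3 L) (criticalBeta 3) 0 bc (spinMonomial y))
      atTop (𝓝 (criticalCorr 3 n y)) :=
  criticalCorr_wellDefined_holds (d := 3) le_rfl n y bc hbc

/-- `|criticalCorr 3 n y| ≤ 1`, odd orders vanish, `U₄^{lat} ≤ 0`: the three a-priori facts every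
argument below uses. [cite: Lebowitz1974, Theorem, eq. (2.5b)] -/
theorem criticalCorr_apriori (n : ℕ) (y : Fin n → Site 3) (z : Fin 4 → Site 3) :
    |criticalCorr 3 n y| ≤ 1 ∧ (Odd n → criticalCorr 3 n y = 0) ∧
    criticalCorr 3 4 z - (criticalCorr 3 2 ![z 0, z 1] * criticalCorr 3 2 ![z 2, z 3]
        + criticalCorr 3 2 ![z 0, z 2] * criticalCorr 3 2 ![z 1, z 3]
        + criticalCorr 3 2 ![z 0, z 3] * criticalCorr 3 2 ![z 1, z 2]) ≤ 0 :=
  ⟨abs_criticalCorr_le_one le_rfl n y, fun hn => criticalCorr_eq_zero_of_odd le_rfl hn y,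
    criticalUrsellFour_nonpos le_rfl z⟩

/-! ## §A Load-bearing analysis -/

/-- The crux with `IsNondegenerateTwoPoint` DROPPED. -/
def CruxWithoutNondegeneracy : Prop :=
  ∀ (ρ : ℝ → ℝ) (S : CorrFamily 3), (∀ δ ∈ Set.Ioc (0:ℝ) 1, 0 < ρ δ) →
    HasPointwiseScalingLimit (criticalCorr 3) ρ S → HasNontrivialU4 S

/-- The zero family (with the correct constant at `n = 0`). -/
def zeroFamily : CorrFamily 3 := fun n _ =>
  if n = 0 then criticalCorr 3 0 (fun _ => 0) else 0

/-- `ρ δ = δ` renormalises the critical correlators to the zero family: a GENUINE pointwise scaling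
limit of `criticalCorr 3` (`|⟨∏σ⟩| ≤ 1`, so `|δⁿ⟨∏σ⟩| ≤ δ → 0` uniformly for `n ≥ 1`; `n = 0` is a
constant). [folklore] -/
theorem hasPointwiseScalingLimit_zeroFamily :
    HasPointwiseScalingLimit (criticalCorr 3) (fun δ => δ) zeroFamily := by
  intro n
  rcases Nat.eq_zero_or_pos n with rfl | hn
  · -- constant family
    refine TendstoUniformlyOn.tendstoLocallyUniformlyOn (Metric.tendstoUniformlyOn_iff.2 ?_)
    intro ε hε
    refine Filter.Eventually.of_forall fun δ x _ => ?_
    have hx : (fun i : Fin 0 => latticeApprox δ (x i)) = fun _ => (0 : Site 3) :=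
      funext fun i => i.elim0
    rw [rescaledCorrelator_apply, hx]
    simp [zeroFamily, hε]
  · refine TendstoUniformlyOn.tendstoLocallyUniformlyOn (Metric.tendstoUniformlyOn_iff.2 ?_)
    intro ε hε
    have hm : Set.Ioo (0:ℝ) (min 1 ε) ∈ 𝓝[>] (0:ℝ) := Ioo_mem_nhdsGT (lt_min one_pos hε)
    filter_upwards [hm] with δ hδ x _
    have hn0 : n ≠ 0 := hn.ne'
    simp only [zeroFamily, if_neg hn0, rescaledCorrelator_apply, Real.dist_eq, zero_sub, abs_neg, abs_mul,
      abs_pow, abs_of_pos hδ.1]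
    have h1 : |criticalCorr 3 n fun i => latticeApprox δ (x i)| ≤ 1 := abs_criticalCorr_le_one le_rfl _ _
    have hδ1 : δ < 1 := hδ.2.trans_le (min_le_left _ _)
    have hδε : δ < ε := hδ.2.trans_le (min_le_right _ _)
    calc δ ^ n * |criticalCorr 3 n fun i => latticeApprox δ (x i)| ≤ δ ^ n * 1 :=
          mul_le_mul_of_nonneg_left h1 (pow_nonneg hδ.1.le n)
      _ ≤ δ ^ 1 * 1 := by
          refine mul_le_mul_of_nonneg_right (pow_le_pow_of_le_one hδ.1.le hδ1.le hn) zero_le_one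
      _ < ε := by simpa using hδε

/-- The zero family has `U₄ ≡ 0`. -/
theorem not_hasNontrivialU4_zeroFamily : ¬ HasNontrivialU4 zeroFamily := by
  rintro ⟨x, -, hne⟩
  exact hne (by simp [limitConnectedFour, zeroFamily])

/-- **§A.1 — non-degeneracy is load-bearing**: without `IsNondegenerateTwoPoint` the crux is FALSE
(witness `ρ δ = δ`, limit `≡ 0`). Any proof must use `S₂ > 0` — in fact only through the scale it
fixes (§B `iff_exists_form`) and the sign of `U₄/S₂S₂` (§C). [folklore] -/
theorem false_without_nondegeneracy : ¬ CruxWithoutNondegeneracy := fun h =>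
  not_hasNontrivialU4_zeroFamily
    (h (fun δ => δ) zeroFamily (fun _ hδ => hδ.1) hasPointwiseScalingLimit_zeroFamily)

/-- The crux with the LATTICE CLAUSE dropped (model-blind). -/
def CruxWithoutLatticeClause : Prop :=
  ∀ S : CorrFamily 3, IsNondegenerateTwoPoint S → HasNontrivialU4 S

/-- **§A.2 — the lattice clause is load-bearing**: FALSE without it (generalised free field of any
dimension `Δ`; tree file `GeneralisedFreeFamily`). [cite: FrancescoMathieuSenechal1997, §4.3.1] -/
theorem false_without_latticeClause : ¬ CruxWithoutLatticeClause := fun h =>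
  not_hasNontrivialU4_gff (1/2 + 1/50) (h _ (isNondegenerateTwoPoint_gff _))

/-- **§A.2′ — … even with full Möbius covariance inside the Ising window `Δ ∈ [1/2,1]`**
(`not_intrinsic_strengthening`): no list of covariance properties of `S` replaces the lattice clause;
the GFF of dimension `Δ_σ ≈ 0.518` is a legitimate (reflection-positive for `Δ ≥ 1/2`) conformal
four-point structure with `U₄ ≡ 0`. What distinguishes Ising₃ from it is NOT visible at the level of
the predicates of `ScalingLimit.lean`/`ConformalCovariance.lean`. [cite: FrancescoMathieuSenechal1997, §4.3.1] -/
theorem false_without_latticeClause_moebius :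
    ¬ ∀ (Δ : ℝ) (S : CorrFamily 3), 1/2 ≤ Δ → Δ ≤ 1 → IsNondegenerateTwoPoint S →
      IsMoebiusCovariant Δ S → HasNontrivialU4 S :=
  not_intrinsic_strengthening

/-- The crux with NO condition on the renormalisation `ρ`. -/
def CruxWithoutPositivity : Prop :=
  ∀ (ρ : ℝ → ℝ) (S : CorrFamily 3),
    HasPointwiseScalingLimit (criticalCorr 3) ρ S → IsNondegenerateTwoPoint S → HasNontrivialU4 S

/-- A reference non-coincident pair `(0, e₀)`. -/
theorem refPair_mem : (![0, EuclideanSpace.single (0 : Fin 3) (1:ℝ)] : Fin 2 → EuclideanSpace ℝ (Fin 3))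
    ∈ NonCoincident 3 2 := by
  refine pair_mem_nonCoincident fun h => ?_
  have := congrArg (fun v : EuclideanSpace ℝ (Fin 3) => v 0) h
  simp at this

/-- A limit with `S₂ > 0` at one pair forces `ρ δ ≠ 0` for all small `δ`. [folklore] -/
theorem eventually_ne_zero_of_limit {ρ : ℝ → ℝ} {S : CorrFamily 3}
    (hlim : HasPointwiseScalingLimit (criticalCorr 3) ρ S) (hnd : IsNondegenerateTwoPoint S) :
    ∀ᶠ δ in 𝓝[>] (0:ℝ), ρ δ ≠ 0 := by
  have h := ((hlim 2).tendsto_at refPair_mem).eventually_const_lt (hnd _ refPair_mem)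
  filter_upwards [h] with δ hδ h0
  rw [rescaledCorrelator_apply, h0] at hδ
  norm_num at hδ

/-- **§A.3 — positivity of `ρ` is cosmetic**: `Crux ↔ CruxWithoutPositivity`. (Odd critical
correlators vanish since `m*(β_c) = 0`, so `|ρ|` has the same limit as `ρ`, and `ρ ≠ 0` eventually by
non-degeneracy; `HasPointwiseScalingLimit.exists_pos_renormalisation`.) A prover may therefore fix any
convenient sign/normalisation convention; a refuter gains nothing from exotic `ρ`. [folklore] -/
theorem iff_withoutPositivity : Crux ↔ CruxWithoutPositivity := by
  refine ⟨fun h ρ S hlim hnd => ?_, fun h ρ S _ hlim hnd => h ρ S hlim hnd⟩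
  obtain ⟨ρ', hρ', hlim'⟩ := hlim.exists_pos_renormalisation
    (fun n hn y => criticalCorr_eq_zero_of_odd le_rfl hn y) (eventually_ne_zero_of_limit hlim hnd)
  exact h ρ' S (fun δ _ => hρ' δ) hlim' hnd

/-! ## §B Structure of every pointwise limit (any `ρ`; inputs: tree files `CriticalUrsellFourSign`,
`PointwiseScalingLimitScale`) -/

/-- **§B.1 Lebowitz in the limit**: `U₄^S ≤ 0` on non-coincident quadruples for EVERY pointwise limit
of `criticalCorr 3`. So the crux is one-sided. [cite: Lebowitz1974, Theorem, eq. (2.5b)] -/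
theorem U4_nonpos {ρ : ℝ → ℝ} {S : CorrFamily 3} (hlim : HasPointwiseScalingLimit (criticalCorr 3) ρ S)
    {x : Fin 4 → EuclideanSpace ℝ (Fin 3)} (hx : x ∈ NonCoincident 3 4) : limitConnectedFour S x ≤ 0 :=
  limitConnectedFour_nonpos_of_hasPointwiseScalingLimit le_rfl hlim hx

/-- **§B.2** `Crux ⇔` every non-degenerate limit has a quadruple with `U₄^S < 0`. [cite: Aizenman1982, §1] -/
theorem iff_exists_neg : Crux ↔ ∀ (ρ : ℝ → ℝ) (S : CorrFamily 3), (∀ δ ∈ Set.Ioc (0:ℝ) 1, 0 < ρ δ) →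
    HasPointwiseScalingLimit (criticalCorr 3) ρ S → IsNondegenerateTwoPoint S →
      ∃ x ∈ NonCoincident 3 4, limitConnectedFour S x < 0 := by
  refine forall₂_congr fun ρ S => forall_congr' fun hρ => forall_congr' fun hlim =>
    forall_congr' fun _ => ?_
  exact hasNontrivialU4_iff_exists_neg_of_hasPointwiseScalingLimit le_rfl hlim

/-- **§B.3 `|U₄^S(x)| ≤ 2 S₂(x₀,x₁) S₂(x₂,x₃)`** for every pointwise limit (ADC 2021 (3.12) in the
limit): with §B.1, `p(x) := -U₄^S(x) / (2 S₂(x₀,x₁)S₂(x₂,x₃)) ∈ [0,1]` — the limiting probability that the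
double-current clusters of `{x₀,x₁}` and `{x₂,x₃}` intersect; the crux says `p ≢ 0`. A refutation
must show `p ≡ 0`; no cheaper target exists (§B.5). [cite: AizenmanDuminilCopinAnnals2021, eq. (3.12)] -/
theorem abs_U4_le_two_mul {ρ : ℝ → ℝ} {S : CorrFamily 3} (hlim : HasPointwiseScalingLimit (criticalCorr 3) ρ S)
    {x : Fin 4 → EuclideanSpace ℝ (Fin 3)} (hx : x ∈ NonCoincident 3 4) :
    |limitConnectedFour S x| ≤ 2 * S 2 ![x 0, x 1] * S 2 ![x 2, x 3] := by
  have hinj : Function.Injective x := hx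
  have hpair : ∀ i j, i ≠ j → Tendsto
      (fun δ => ρ δ ^ 2 * criticalCorr 3 2 ![latticeApprox δ (x i), latticeApprox δ (x j)])
      (𝓝[>] 0) (𝓝 (S 2 ![x i, x j])) := by
    intro i j hij
    have hmem : (![x i, x j] : Fin 2 → EuclideanSpace ℝ (Fin 3)) ∈ NonCoincident 3 2 :=
      pair_mem_nonCoincident fun h => hij (hinj h)
    refine Tendsto.congr (fun δ => ?_) ((hlim 2).tendsto_at hmem)
    rw [rescaledCorrelator_apply, latticeApprox_comp_two]
    rfl
  have hU := (tendsto_rescaled_criticalUrsellFour hlim hx).abs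
  have hB := ((hpair 0 1 (by decide)).const_mul 2).mul (hpair 2 3 (by decide))
  refine le_of_tendsto_of_tendsto hU hB (Filter.Eventually.of_forall fun δ => ?_)
  have h := abs_criticalUrsellFour_le_two_mul (d := 3) le_rfl (fun i => latticeApprox δ (x i))
  have h4 : (0:ℝ) ≤ ρ δ ^ 4 := by positivity
  calc |ρ δ ^ 4 * _| = ρ δ ^ 4 * |_| := by rw [abs_mul, abs_of_nonneg h4]
    _ ≤ ρ δ ^ 4 * (2 * criticalCorr 3 2 ![latticeApprox δ (x 0), latticeApprox δ (x 1)] *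
          criticalCorr 3 2 ![latticeApprox δ (x 2), latticeApprox δ (x 3)]) :=
        mul_le_mul_of_nonneg_left h h4
    _ = 2 * (ρ δ ^ 2 * criticalCorr 3 2 ![latticeApprox δ (x 0), latticeApprox δ (x 1)]) *
          (ρ δ ^ 2 * criticalCorr 3 2 ![latticeApprox δ (x 2), latticeApprox δ (x 3)]) := by ring

/-- **§B.4 ∀-form ⇔ ∃-form, given existence**: two non-degenerate limits differ by `c^n`, `c > 0`
(`exists_scale_of_isNondegenerateTwoPoint`), and `HasNontrivialU4` is scale-invariant; hence the crux
is equivalent to "IF a non-degenerate limit exists THEN SOME non-degenerate limit has `U₄ ≢ 0`". In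
particular the crux is VACUOUSLY TRUE if `criticalCorr 3` has no (full-filter, all-`n`) non-degenerate
pointwise limit — a refutation needs existence first (crux r6 of IsingEuclidUpgrade). [folklore] -/
theorem iff_exists_form : Crux ↔
    ((∃ (ρ : ℝ → ℝ) (S : CorrFamily 3), (∀ δ ∈ Set.Ioc (0:ℝ) 1, 0 < ρ δ) ∧
        HasPointwiseScalingLimit (criticalCorr 3) ρ S ∧ IsNondegenerateTwoPoint S) →
      ∃ (ρ : ℝ → ℝ) (S : CorrFamily 3), (∀ δ ∈ Set.Ioc (0:ℝ) 1, 0 < ρ δ) ∧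
        HasPointwiseScalingLimit (criticalCorr 3) ρ S ∧ IsNondegenerateTwoPoint S ∧ HasNontrivialU4 S) := by
  constructor
  · rintro h ⟨ρ, S, hρ, hlim, hnd⟩
    exact ⟨ρ, S, hρ, hlim, hnd, h ρ S hρ hlim hnd⟩
  · intro h ρ S hρ hlim hnd
    obtain ⟨ρ', S', hρ', hlim', hnd', hU'⟩ := h ⟨ρ, S, hρ, hlim, hnd⟩
    obtain ⟨c, hc, hscale⟩ :=
      hlim'.exists_scale_of_isNondegenerateTwoPoint (by norm_num) hρ' hρ hlim hnd' hnd
    exact (hasNontrivialU4_iff_of_scale hc.ne' hscale).2 hU'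

/-! ### §B.3′ The GKS floor: `U₄^S ≥ -(S₂S₂ + S₂S₂)` (the other half of the "pinned sandwich") -/

/-- Spin monomial of an injective tuple = spin product of its image. [folklore] -/
theorem spinMonomial_eq_spinProduct_of_injective {n : ℕ} {y : Fin n → Site 3}
    (hy : Function.Injective y) : spinMonomial y = spinProduct (Finset.univ.image y) := by
  funext s
  unfold spinMonomial spinProduct
  rw [Finset.prod_image fun i _ j _ h => hy h]

/-- **GKS II for the critical state**: `⟨σ_{y₀}σ_{y₁}⟩_{β_c}⟨σ_{y₂}σ_{y₃}⟩_{β_c} ≤ ⟨σ_{y₀}σ_{y₁}σ_{y₂}σ_{y₃}⟩_{β_c}`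
for DISTINCT lattice points (box limit of the tree theorem `GKSInequalities.gks_two_holds`, free b.c.).
[cite: FriedliVelenik2017, Thm. 3.20, eq. (3.22), p. 109] -/
theorem criticalCorr_two_mul_two_le_four {y : Fin 4 → Site 3} (hy : Function.Injective y) :
    criticalCorr 3 2 ![y 0, y 1] * criticalCorr 3 2 ![y 2, y 3] ≤ criticalCorr 3 4 y := by
  classical
  have hmem : (BoundaryCondition.free : BoundaryCondition (Site 3)) ∈
      ({.free, .plus, .minus} : Set (BoundaryCondition (Site 3))) := by simp
  have h4 := criticalCorr_is_boxLimit 4 y .free hmem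
  have h01 := criticalCorr_is_boxLimit 2 ![y 0, y 1] .free hmem
  have h23 := criticalCorr_is_boxLimit 2 ![y 2, y 3] .free hmem
  refine le_of_tendsto_of_tendsto (h01.mul h23) h4 ?_
  filter_upwards [eventually_forall_mem_box y] with L hL
  -- rewrite the three expectations as set-indexed correlations and apply GKS II
  have hinj01 : Function.Injective (![y 0, y 1] : Fin 2 → Site 3) := by
    intro i j h; fin_cases i <;> fin_cases j
    · rfl
    · exact absurd (hy h) (by decide)
    · exact absurd (hy h) (by decide)
    · rfl
  have hinj23 : Function.Injective (![y 2, y 3] : Fin 2 → Site 3) := by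
    intro i j h; fin_cases i <;> fin_cases j
    · rfl
    · exact absurd (hy h) (by decide)
    · exact absurd (hy h) (by decide)
    · rfl
  have hA : (Finset.univ.image ![y 0, y 1] : Finset (Site 3)) = {y 0, y 1} := by
    ext v
    simp only [Finset.mem_image, Finset.mem_univ, true_and, Fin.exists_fin_two, Matrix.cons_val_zero,
      Matrix.cons_val_one, Finset.mem_insert, Finset.mem_singleton]
    constructor
    · rintro (h | h); exacts [Or.inl h.symm, Or.inr h.symm]
    · rintro (h | h); exacts [Or.inl h.symm, Or.inr h.symm]
  have hB : (Finset.univ.image ![y 2, y 3] : Finset (Site 3)) = {y 2, y 3} := by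
    ext v
    simp only [Finset.mem_image, Finset.mem_univ, true_and, Fin.exists_fin_two, Matrix.cons_val_zero,
      Matrix.cons_val_one, Finset.mem_insert, Finset.mem_singleton]
    constructor
    · rintro (h | h); exacts [Or.inl h.symm, Or.inr h.symm]
    · rintro (h | h); exacts [Or.inl h.symm, Or.inr h.symm]
  have hAB : ({y 0, y 1} : Finset (Site 3)) ∆ {y 2, y 3} = Finset.univ.image y := by
    ext v
    simp only [Finset.mem_symmDiff, Finset.mem_insert, Finset.mem_singleton, Finset.mem_image,
      Finset.mem_univ, true_and]
    have h02 : y 0 ≠ y 2 := fun h => absurd (hy h) (by decide)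
    have h03 : y 0 ≠ y 3 := fun h => absurd (hy h) (by decide)
    have h12 : y 1 ≠ y 2 := fun h => absurd (hy h) (by decide)
    have h13 : y 1 ≠ y 3 := fun h => absurd (hy h) (by decide)
    constructor
    · rintro (⟨h | h, -⟩ | ⟨h | h, -⟩)
      · exact ⟨0, h.symm⟩
      · exact ⟨1, h.symm⟩
      · exact ⟨2, h.symm⟩
      · exact ⟨3, h.symm⟩
    · rintro ⟨i, rfl⟩
      fin_cases i
      · exact Or.inl ⟨Or.inl rfl, fun h => h.elim (fun h => h02 h) (fun h => h03 h)⟩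
      · exact Or.inl ⟨Or.inr rfl, fun h => h.elim (fun h => h12 h) (fun h => h13 h)⟩
      · exact Or.inr ⟨Or.inl rfl, fun h => h.elim (fun h => h02 h.symm) (fun h => h12 h.symm)⟩
      · exact Or.inr ⟨Or.inr rfl, fun h => h.elim (fun h => h03 h.symm) (fun h => h13 h.symm)⟩
  have e4 : isingExpect (zdGraph 3) (box 3 L) (criticalBeta 3) 0 .free (spinMonomial y) =
      isingCorr (zdGraph 3) (box 3 L) (criticalBeta 3) 0 .free (({y 0, y 1} : Finset (Site 3)) ∆ {y 2, y 3}) := by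
    rw [isingCorr, hAB, spinMonomial_eq_spinProduct_of_injective hy]
  have e01 : isingExpect (zdGraph 3) (box 3 L) (criticalBeta 3) 0 .free (spinMonomial ![y 0, y 1]) =
      isingCorr (zdGraph 3) (box 3 L) (criticalBeta 3) 0 .free {y 0, y 1} := by
    rw [isingCorr, spinMonomial_eq_spinProduct_of_injective hinj01, hA]
  have e23 : isingExpect (zdGraph 3) (box 3 L) (criticalBeta 3) 0 .free (spinMonomial ![y 2, y 3]) =
      isingCorr (zdGraph 3) (box 3 L) (criticalBeta 3) 0 .free {y 2, y 3} := by
    rw [isingCorr, spinMonomial_eq_spinProduct_of_injective hinj23, hB]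
  rw [e4, e01, e23]
  refine GKSInequalities.gks_two_holds (zdGraph 3) (criticalBeta_nonneg 3) le_rfl (Or.inl rfl) ?_ ?_
  · intro v hv
    simp only [Finset.mem_insert, Finset.mem_singleton] at hv
    rcases hv with rfl | rfl
    · exact hL 0
    · exact hL 1
  · intro v hv
    simp only [Finset.mem_insert, Finset.mem_singleton] at hv
    rcases hv with rfl | rfl
    · exact hL 2
    · exact hL 3

/-- The lattice approximation of a non-coincident configuration is injective for small `δ`. [folklore] -/
theorem eventually_injective_latticeApprox {n : ℕ} {x : Fin n → EuclideanSpace ℝ (Fin 3)}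
    (hx : x ∈ NonCoincident 3 n) :
    ∀ᶠ δ in 𝓝[>] (0:ℝ), Function.Injective fun i => latticeApprox δ (x i) := by
  have hinj : Function.Injective x := hx
  have hpair : ∀ i j : Fin n, i ≠ j → ∀ᶠ δ in 𝓝[>] (0:ℝ), latticeApprox δ (x i) ≠ latticeApprox δ (x j) := by
    intro i j hij
    have hr : 0 < ‖WithLp.ofLp (x i) - WithLp.ofLp (x j)‖ := by
      rw [norm_pos_iff, sub_ne_zero]
      exact fun h => hij (hinj ((WithLp.ofLp_injective 2) h))
    have hm : Set.Ioo (0:ℝ) (‖WithLp.ofLp (x i) - WithLp.ofLp (x j)‖ / 3) ∈ 𝓝[>] (0:ℝ) :=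
      Ioo_mem_nhdsGT (by positivity)
    filter_upwards [hm] with δ hδ heq
    have h := le_supNorm_latticeApprox_sub (d := 3) (by norm_num) hδ.1 (x i) (x j)
    rw [heq, sub_self] at h
    have h0 : (Site.supNorm (0 : Site 3) : ℝ) = 0 := by
      rw [← Site.norm_eq_supNorm]; simp
    rw [h0] at h
    have := hδ.2
    rw [lt_div_iff₀ (by norm_num : (0:ℝ) < 3)] at this
    rw [sub_nonpos, div_le_iff₀ hδ.1] at h
    linarith
  have hall : ∀ᶠ δ in 𝓝[>] (0:ℝ), ∀ i j : Fin n,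
      latticeApprox δ (x i) = latticeApprox δ (x j) → i = j := by
    refine Filter.eventually_all.2 fun i => Filter.eventually_all.2 fun j => ?_
    by_cases hij : i = j
    · exact Filter.Eventually.of_forall fun δ _ => hij
    · exact (hpair i j hij).mono fun δ hδ h => absurd h hδ
  exact hall.mono fun δ h => fun i j hij => h i j hij

/-- **§B.3′ the GKS floor in the limit**: for every pointwise limit of `criticalCorr 3` (any `ρ`) and
non-coincident `x`, `S₂(x₀,x₁)S₂(x₂,x₃) ≤ S₄(x)`, i.e.
`U₄^S(x) ≥ -(S₂(x₀,x₂)S₂(x₁,x₃) + S₂(x₀,x₃)S₂(x₁,x₂))`. With §B.1 this is the "pinned sandwich"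
`-cross ≤ U₄^S ≤ 0` of crux idea pinned-ursell-ratio-boundary-layer: the ratio `V := U₄^S/cross ∈ [-1,0]`,
Gaussian ⇔ `V ≡ 0`. [cite: FriedliVelenik2017, Thm. 3.20, eq. (3.22), p. 109] -/
theorem two_mul_two_le_four {ρ : ℝ → ℝ} {S : CorrFamily 3}
    (hlim : HasPointwiseScalingLimit (criticalCorr 3) ρ S)
    {x : Fin 4 → EuclideanSpace ℝ (Fin 3)} (hx : x ∈ NonCoincident 3 4) :
    S 2 ![x 0, x 1] * S 2 ![x 2, x 3] ≤ S 4 x := by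
  have hinj : Function.Injective x := hx
  have hpair : ∀ i j, i ≠ j → Tendsto
      (fun δ => ρ δ ^ 2 * criticalCorr 3 2 ![latticeApprox δ (x i), latticeApprox δ (x j)])
      (𝓝[>] 0) (𝓝 (S 2 ![x i, x j])) := by
    intro i j hij
    have hmem : (![x i, x j] : Fin 2 → EuclideanSpace ℝ (Fin 3)) ∈ NonCoincident 3 2 :=
      pair_mem_nonCoincident fun h => hij (hinj h)
    refine Tendsto.congr (fun δ => ?_) ((hlim 2).tendsto_at hmem)
    rw [rescaledCorrelator_apply, latticeApprox_comp_two]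
    rfl
  have h4 : Tendsto (fun δ => ρ δ ^ 4 * criticalCorr 3 4 (fun i => latticeApprox δ (x i))) (𝓝[>] 0)
      (𝓝 (S 4 x)) := (hlim 4).tendsto_at hx
  refine le_of_tendsto_of_tendsto ((hpair 0 1 (by decide)).mul (hpair 2 3 (by decide))) h4 ?_
  filter_upwards [eventually_injective_latticeApprox hx] with δ hδ
  have h := criticalCorr_two_mul_two_le_four hδ
  have hρ4 : (0:ℝ) ≤ ρ δ ^ 4 := by positivity
  calc ρ δ ^ 2 * criticalCorr 3 2 ![latticeApprox δ (x 0), latticeApprox δ (x 1)] *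
        (ρ δ ^ 2 * criticalCorr 3 2 ![latticeApprox δ (x 2), latticeApprox δ (x 3)])
      = ρ δ ^ 4 * (criticalCorr 3 2 ![latticeApprox δ (x 0), latticeApprox δ (x 1)] *
          criticalCorr 3 2 ![latticeApprox δ (x 2), latticeApprox δ (x 3)]) := by ring
    _ ≤ ρ δ ^ 4 * criticalCorr 3 4 (fun i => latticeApprox δ (x i)) := mul_le_mul_of_nonneg_left h hρ4

/-- **§B.3″ the pinned sandwich** `-(S₂(x₀,x₂)S₂(x₁,x₃) + S₂(x₀,x₃)S₂(x₁,x₂)) ≤ U₄^S(x) ≤ 0`. -/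
theorem U4_sandwich {ρ : ℝ → ℝ} {S : CorrFamily 3}
    (hlim : HasPointwiseScalingLimit (criticalCorr 3) ρ S)
    {x : Fin 4 → EuclideanSpace ℝ (Fin 3)} (hx : x ∈ NonCoincident 3 4) :
    -(S 2 ![x 0, x 2] * S 2 ![x 1, x 3] + S 2 ![x 0, x 3] * S 2 ![x 1, x 2]) ≤ limitConnectedFour S x ∧
      limitConnectedFour S x ≤ 0 := by
  refine ⟨?_, U4_nonpos hlim hx⟩
  have h := two_mul_two_le_four hlim hx
  simp only [limitConnectedFour]
  linarith

/-! ### §B.5 The Gaussian dichotomy (tree files `CriticalWickDichotomy` p69474, `CriticalWickIff`,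
both from this seat) -/

/-- **Full Gaussianity on non-coincident configurations**: Wick's rule at every even order `2n ≥ 4`
(`𝒢_n[S₂]` = `pairingSum`; at order four this is `U₄ ≡ 0`, `pairingSum_two`; odd orders of a limit
of `criticalCorr 3` vanish anyway, `HasPointwiseScalingLimit.eq_zero_of_odd`). -/
def IsGaussianOnNC (S : CorrFamily 3) : Prop :=
  ∀ n : ℕ, 2 ≤ n → ∀ x ∈ NonCoincident 3 (2 * n), S (2 * n) x = pairingSum (fun p q => S 2 ![p, q]) n x

/-- **§B.5 — the negation of the crux's conclusion is EXACTLY full Gaussianity** (Aizenman 1982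
Prop. 12.1 passed to the pointwise limit; Aizenman CDM 2020 p. 23; Newman 1975): for every pointwise
limit `S` of `criticalCorr 3` (any `ρ`), `¬ HasNontrivialU4 S ↔ IsGaussianOnNC S`. So a counterexample
to the crux is necessarily the complete Wick family `S_{2n} = 𝒢_n[S₂]`, `S_{2n+1} = 0` of its own
two-point function — there is no "partially non-Gaussian" escape — and conversely a prover may detect
non-Gaussianity at ANY even order (`hasNontrivialU4_of_ne_wick`). [cite: AizenmanCDM2020, §7, Prop. 7.1–7.2 and remark p. 23] -/
theorem not_hasNontrivialU4_iff_gaussian {ρ : ℝ → ℝ} {S : CorrFamily 3}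
    (hlim : HasPointwiseScalingLimit (criticalCorr 3) ρ S) : ¬ HasNontrivialU4 S ↔ IsGaussianOnNC S :=
  hlim.not_hasNontrivialU4_iff_wick le_rfl

/-- **§B.5′ `Crux ⇔` "no non-degenerate pointwise limit of the critical Ising₃ correlators is
Gaussian"** — the crux is literally the non-triviality problem, nothing weaker. -/
theorem iff_nonGaussian : Crux ↔ ∀ (ρ : ℝ → ℝ) (S : CorrFamily 3), (∀ δ ∈ Set.Ioc (0:ℝ) 1, 0 < ρ δ) →
    HasPointwiseScalingLimit (criticalCorr 3) ρ S → IsNondegenerateTwoPoint S → ¬ IsGaussianOnNC S := by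
  refine forall₂_congr fun ρ S => forall_congr' fun _ => forall_congr' fun hlim =>
    forall_congr' fun _ => ?_
  rw [← not_hasNontrivialU4_iff_gaussian hlim, not_not]

/-- **§B.5″ any non-Wick value at any even order proves the crux's conclusion** for that limit. -/
theorem hasNontrivialU4_of_ne_wick {ρ : ℝ → ℝ} {S : CorrFamily 3}
    (hlim : HasPointwiseScalingLimit (criticalCorr 3) ρ S) {n : ℕ} (hn : 2 ≤ n)
    {x : Fin (2 * n) → EuclideanSpace ℝ (Fin 3)} (hx : x ∈ NonCoincident 3 (2 * n))
    (hne : S (2 * n) x ≠ pairingSum (fun p q => S 2 ![p, q]) n x) : HasNontrivialU4 S :=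
  hlim.hasNontrivialU4_of_ne_pairingSum le_rfl hn hx hne

/-- **§B.5‴ `U₄^S = S₄ - 𝒢₂[S₂]`** and the two-point function of every limit is symmetric. -/
theorem U4_eq_sub_pairingSum {ρ : ℝ → ℝ} {S : CorrFamily 3}
    (hlim : HasPointwiseScalingLimit (criticalCorr 3) ρ S) (x : Fin 4 → EuclideanSpace ℝ (Fin 3)) :
    limitConnectedFour S x = S 4 x - pairingSum (fun p q => S 2 ![p, q]) 2 x :=
  hlim.limitConnectedFour_eq_sub_pairingSum x

/-! ### §B.6 Scale covariance is AUTOMATIC (tree file `PointwiseScalingLimitScaleCovariant`, from this seat) -/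

/-- **§B.6 — every non-degenerate pointwise limit of `criticalCorr 3` is scale covariant on
non-coincident configurations with SOME `Δ ∈ [1/2, 1]`** (self-similarity + uniqueness up to scale +
MMS + "monotone additive ⇒ linear"; the window from `scalingDimension_mem_Icc_holds`). Consequences
for the crux: (i) the hypotheses of sibling clauses "scale covariant with some Δ" add nothing;
(ii) `U₄^S(c·x) = c^{-4Δ} U₄^S(x)` (`U4_smul`), so `p(x)` depends only on the SHAPE of the quadruple
and the witness of `HasNontrivialU4` may be normalised to unit size; (iii) the Gaussian scenario of
§E.3 is a self-similar field with `S₂ = f(direction)‖x-y‖^{-2Δ}`. [cite: DuminilCopin2019, Thm. 4.8, §4.4] -/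
theorem exists_scale_covariance {ρ : ℝ → ℝ} {S : CorrFamily 3}
    (hρ : ∀ δ ∈ Set.Ioc (0:ℝ) 1, 0 < ρ δ) (hlim : HasPointwiseScalingLimit (criticalCorr 3) ρ S)
    (hnd : IsNondegenerateTwoPoint S) :
    ∃ Δ ∈ Set.Icc (1/2 : ℝ) 1, ∀ (n : ℕ) (c : ℝ), 0 < c → ∀ x ∈ NonCoincident 3 n,
      S n (fun i => c • x i) = c ^ (-(n : ℝ) * Δ) * S n x :=
  hlim.exists_rpow_scale_mem_Icc hρ hnd

/-- Pairs of a scaled configuration are scaled pairs. [folklore] -/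
theorem pair_smul (c : ℝ) (x : Fin 4 → EuclideanSpace ℝ (Fin 3)) (i j : Fin 4) :
    (![c • x i, c • x j] : Fin 2 → EuclideanSpace ℝ (Fin 3)) = fun k => c • (![x i, x j] k) := by
  funext k
  fin_cases k <;> rfl

/-- **§B.6′ `U₄^S(c·x) = c^{-4Δ}·U₄^S(x)`** for the automatic `Δ` of a non-degenerate limit:
`HasNontrivialU4` is decided at any one scale of each shape. [folklore] -/
theorem U4_smul {ρ : ℝ → ℝ} {S : CorrFamily 3}
    (hρ : ∀ δ ∈ Set.Ioc (0:ℝ) 1, 0 < ρ δ) (hlim : HasPointwiseScalingLimit (criticalCorr 3) ρ S)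
    (hnd : IsNondegenerateTwoPoint S) :
    ∃ Δ ∈ Set.Icc (1/2 : ℝ) 1, ∀ (c : ℝ), 0 < c → ∀ x ∈ NonCoincident 3 4,
      limitConnectedFour S (fun i => c • x i) = c ^ (-(4 : ℝ) * Δ) * limitConnectedFour S x := by
  obtain ⟨Δ, hΔ, hcov⟩ := exists_scale_covariance hρ hlim hnd
  refine ⟨Δ, hΔ, fun c hc x hx => ?_⟩
  have hinj : Function.Injective x := hx
  have h4 : S 4 (fun i => c • x i) = c ^ (-(4 : ℝ) * Δ) * S 4 x := by exact_mod_cast hcov 4 c hc x hx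
  have h2 : ∀ i j, i ≠ j → S 2 ![c • x i, c • x j] = c ^ (-(2 : ℝ) * Δ) * S 2 ![x i, x j] := by
    intro i j hij
    rw [pair_smul]
    exact_mod_cast hcov 2 c hc _ (pair_mem_nonCoincident fun h => hij (hinj h))
  have hcc : c ^ (-(2 : ℝ) * Δ) * c ^ (-(2 : ℝ) * Δ) = c ^ (-(4 : ℝ) * Δ) := by
    rw [← Real.rpow_add hc]; ring_nf
  simp only [limitConnectedFour]
  rw [h4, h2 0 1 (by decide), h2 2 3 (by decide), h2 0 2 (by decide), h2 1 3 (by decide),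
    h2 0 3 (by decide), h2 1 2 (by decide)]
  have : ∀ a b : ℝ, c ^ (-(2 : ℝ) * Δ) * a * (c ^ (-(2 : ℝ) * Δ) * b) = c ^ (-(4 : ℝ) * Δ) * (a * b) := by
    intro a b; rw [← hcc]; ring
  rw [this, this, this]
  ring

/-- **§B.6″ the renormalisation is regularly varying**: `ρ(cδ)/ρ(δ) → c^{-Δ}` for the automatic `Δ`
(Lamperti-type; DERIVED from the full-filter limit, never assumed — the formal content of "ρ(δ) ≍
δ^{-Δ}"; `exists_rpow_scale_and_ratio`, tree file `PointwiseScalingLimitScaleCovariant` v2, p71137). So a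
counterexample's `ρ` is as rigid as its `S`. [folklore] -/
theorem renormalisation_regularly_varying {ρ : ℝ → ℝ} {S : CorrFamily 3}
    (hρ : ∀ δ ∈ Set.Ioc (0:ℝ) 1, 0 < ρ δ) (hlim : HasPointwiseScalingLimit (criticalCorr 3) ρ S)
    (hnd : IsNondegenerateTwoPoint S) :
    ∃ Δ : ℝ, 0 ≤ Δ ∧ (∀ (n : ℕ) (c : ℝ), 0 < c → ∀ x ∈ NonCoincident 3 n,
      S n (fun i => c • x i) = c ^ (-(n : ℝ) * Δ) * S n x) ∧
      ∀ c : ℝ, 0 < c → Tendsto (fun δ => ρ (c * δ) / ρ δ) (𝓝[>] 0) (𝓝 (c ^ (-Δ))) :=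
  hlim.exists_rpow_scale_and_ratio (by norm_num) hρ hnd

/-! ## §C The ρ-free lattice target -/

/-- The lattice connected four-point function at the mesh-`δ` approximation of `x`. -/
def latU4 (δ : ℝ) (x : Fin 4 → EuclideanSpace ℝ (Fin 3)) : ℝ :=
  criticalCorr 3 4 (fun i => latticeApprox δ (x i)) -
    (criticalCorr 3 2 ![latticeApprox δ (x 0), latticeApprox δ (x 1)] *
        criticalCorr 3 2 ![latticeApprox δ (x 2), latticeApprox δ (x 3)]
      + criticalCorr 3 2 ![latticeApprox δ (x 0), latticeApprox δ (x 2)] *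
        criticalCorr 3 2 ![latticeApprox δ (x 1), latticeApprox δ (x 3)]
      + criticalCorr 3 2 ![latticeApprox δ (x 0), latticeApprox δ (x 3)] *
        criticalCorr 3 2 ![latticeApprox δ (x 1), latticeApprox δ (x 2)])

/-- **LATTICE TARGET (ρ-free, one configuration, one constant)**: at some non-coincident quadruple
`x` and some `c > 0`, `-U₄^{lat}([x/δ]) ≥ c·⟨σ_{[x₀/δ]}σ_{[x₁/δ]}⟩⟨σ_{[x₂/δ]}σ_{[x₃/δ]}⟩` for all
small `δ > 0`. By ADC 2021 (3.11) this says: the probability that the double-current clusters of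
`{[x₀/δ],[x₁/δ]}` and `{[x₂/δ],[x₃/δ]}` intersect is `≥ c/2` uniformly in the scale. -/
def LatticeU4RatioPositive : Prop :=
  ∃ x ∈ NonCoincident 3 4, ∃ c : ℝ, 0 < c ∧ ∀ᶠ δ in 𝓝[>] (0:ℝ),
    c * (criticalCorr 3 2 ![latticeApprox δ (x 0), latticeApprox δ (x 1)] *
      criticalCorr 3 2 ![latticeApprox δ (x 2), latticeApprox δ (x 3)]) ≤ - latU4 δ x

/-- **§C.1 — sufficiency (unconditional)**: `LatticeU4RatioPositive → Crux`. [cite: AizenmanDuminilCopinAnnals2021, eq. (3.11)] -/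
theorem of_latticeU4RatioPositive (h : LatticeU4RatioPositive) : Crux := by
  intro ρ S _ hlim hnd
  obtain ⟨x, hx, c, hc, hev⟩ := h
  have hinj : Function.Injective x := hx
  have hpair : ∀ i j, i ≠ j → Tendsto
      (fun δ => ρ δ ^ 2 * criticalCorr 3 2 ![latticeApprox δ (x i), latticeApprox δ (x j)])
      (𝓝[>] 0) (𝓝 (S 2 ![x i, x j])) := by
    intro i j hij
    have hmem : (![x i, x j] : Fin 2 → EuclideanSpace ℝ (Fin 3)) ∈ NonCoincident 3 2 :=
      pair_mem_nonCoincident fun h => hij (hinj h)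
    refine Tendsto.congr (fun δ => ?_) ((hlim 2).tendsto_at hmem)
    rw [rescaledCorrelator_apply, latticeApprox_comp_two]
    rfl
  have hU : Tendsto (fun δ => ρ δ ^ 4 * latU4 δ x) (𝓝[>] 0) (𝓝 (limitConnectedFour S x)) :=
    tendsto_rescaled_criticalUrsellFour hlim hx
  have hB := (((hpair 0 1 (by decide)).mul (hpair 2 3 (by decide))).const_mul c)
  have hle : c * (S 2 ![x 0, x 1] * S 2 ![x 2, x 3]) ≤ - limitConnectedFour S x := by
    refine le_of_tendsto_of_tendsto hB hU.neg ?_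
    filter_upwards [hev] with δ hδ
    have h4 : (0:ℝ) ≤ ρ δ ^ 4 := by positivity
    have := mul_le_mul_of_nonneg_left hδ h4
    calc c * (ρ δ ^ 2 * criticalCorr 3 2 ![latticeApprox δ (x 0), latticeApprox δ (x 1)] *
          (ρ δ ^ 2 * criticalCorr 3 2 ![latticeApprox δ (x 2), latticeApprox δ (x 3)]))
        = ρ δ ^ 4 * (c * (criticalCorr 3 2 ![latticeApprox δ (x 0), latticeApprox δ (x 1)] *
          criticalCorr 3 2 ![latticeApprox δ (x 2), latticeApprox δ (x 3)])) := by ring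
      _ ≤ ρ δ ^ 4 * (- latU4 δ x) := this
      _ = -(ρ δ ^ 4 * latU4 δ x) := by ring
  have h01 : (![x 0, x 1] : Fin 2 → _) ∈ NonCoincident 3 2 :=
    pair_mem_nonCoincident fun h => absurd (hinj h) (by decide)
  have h23 : (![x 2, x 3] : Fin 2 → _) ∈ NonCoincident 3 2 :=
    pair_mem_nonCoincident fun h => absurd (hinj h) (by decide)
  have hpos : 0 < c * (S 2 ![x 0, x 1] * S 2 ![x 2, x 3]) :=
    mul_pos hc (mul_pos (hnd _ h01) (hnd _ h23))
  exact ⟨x, hx, by linarith⟩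

/-- **§C.2 — necessity, given a non-degenerate limit**: if the crux holds and some non-degenerate
pointwise limit exists, then `LatticeU4RatioPositive` (with `c = p(x)·`const at a quadruple where
`U₄^S < 0`). So, modulo existence, the crux IS this lattice estimate. [cite: AizenmanDuminilCopinAnnals2021, eq. (3.11)] -/
theorem latticeU4RatioPositive_of (h : Crux) {ρ : ℝ → ℝ} {S : CorrFamily 3}
    (hρ : ∀ δ ∈ Set.Ioc (0:ℝ) 1, 0 < ρ δ) (hlim : HasPointwiseScalingLimit (criticalCorr 3) ρ S)
    (hnd : IsNondegenerateTwoPoint S) : LatticeU4RatioPositive := by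
  obtain ⟨x, hx, hneg⟩ := (iff_exists_neg.1 h) ρ S hρ hlim hnd
  have hinj : Function.Injective x := hx
  have hpair : ∀ i j, i ≠ j → Tendsto
      (fun δ => ρ δ ^ 2 * criticalCorr 3 2 ![latticeApprox δ (x i), latticeApprox δ (x j)])
      (𝓝[>] 0) (𝓝 (S 2 ![x i, x j])) := by
    intro i j hij
    have hmem : (![x i, x j] : Fin 2 → EuclideanSpace ℝ (Fin 3)) ∈ NonCoincident 3 2 :=
      pair_mem_nonCoincident fun h => hij (hinj h)
    refine Tendsto.congr (fun δ => ?_) ((hlim 2).tendsto_at hmem)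
    rw [rescaledCorrelator_apply, latticeApprox_comp_two]
    rfl
  set u : ℝ := - limitConnectedFour S x with hu
  set s : ℝ := S 2 ![x 0, x 1] * S 2 ![x 2, x 3] with hs
  have hu0 : 0 < u := by rw [hu]; linarith
  have h01 : (![x 0, x 1] : Fin 2 → _) ∈ NonCoincident 3 2 :=
    pair_mem_nonCoincident fun h => absurd (hinj h) (by decide)
  have h23 : (![x 2, x 3] : Fin 2 → _) ∈ NonCoincident 3 2 :=
    pair_mem_nonCoincident fun h => absurd (hinj h) (by decide)
  have hs0 : 0 < s := mul_pos (hnd _ h01) (hnd _ h23)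
  refine ⟨x, hx, u / (2 * s), by positivity, ?_⟩
  have hU : Tendsto (fun δ => -(ρ δ ^ 4 * latU4 δ x)) (𝓝[>] 0) (𝓝 u) :=
    (tendsto_rescaled_criticalUrsellFour hlim hx).neg
  have hB : Tendsto (fun δ => u / (2 * s) * ((ρ δ ^ 2 *
      criticalCorr 3 2 ![latticeApprox δ (x 0), latticeApprox δ (x 1)]) * (ρ δ ^ 2 *
      criticalCorr 3 2 ![latticeApprox δ (x 2), latticeApprox δ (x 3)]))) (𝓝[>] 0) (𝓝 (u / (2 * s) * s)) :=
    ((hpair 0 1 (by decide)).mul (hpair 2 3 (by decide))).const_mul _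
  have hmid : u / (2 * s) * s < 3 * u / 4 := by
    rw [div_mul_eq_mul_div, mul_comm 2 s, ← div_div, mul_div_assoc, div_self hs0.ne', mul_one]
    linarith
  have hmid' : 3 * u / 4 < u := by linarith
  have hIoc : Set.Ioc (0:ℝ) 1 ∈ 𝓝[>] (0:ℝ) := Ioc_mem_nhdsGT one_pos
  filter_upwards [hB.eventually_lt_const hmid, hU.eventually_const_lt hmid',
    Filter.eventually_of_mem hIoc fun δ hδ => hδ] with δ h1 h2 hδ
  have hρ4 : 0 < ρ δ ^ 4 := pow_pos (hρ δ hδ) 4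
  have key : ρ δ ^ 4 * (u / (2 * s) * (criticalCorr 3 2 ![latticeApprox δ (x 0), latticeApprox δ (x 1)] *
      criticalCorr 3 2 ![latticeApprox δ (x 2), latticeApprox δ (x 3)])) ≤ ρ δ ^ 4 * (- latU4 δ x) := by
    have e1 : ρ δ ^ 4 * (u / (2 * s) * (criticalCorr 3 2 ![latticeApprox δ (x 0), latticeApprox δ (x 1)] *
        criticalCorr 3 2 ![latticeApprox δ (x 2), latticeApprox δ (x 3)])) =
        u / (2 * s) * ((ρ δ ^ 2 * criticalCorr 3 2 ![latticeApprox δ (x 0), latticeApprox δ (x 1)]) *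
          (ρ δ ^ 2 * criticalCorr 3 2 ![latticeApprox δ (x 2), latticeApprox δ (x 3)])) := by ring
    have e2 : ρ δ ^ 4 * (- latU4 δ x) = -(ρ δ ^ 4 * latU4 δ x) := by ring
    rw [e1, e2]
    linarith
  exact le_of_mul_le_mul_left key hρ4

/-- **§C.3** Hence, given existence of a non-degenerate limit, `Crux ↔ LatticeU4RatioPositive`. -/
theorem iff_latticeU4RatioPositive_of_exists {ρ : ℝ → ℝ} {S : CorrFamily 3}
    (hρ : ∀ δ ∈ Set.Ioc (0:ℝ) 1, 0 < ρ δ) (hlim : HasPointwiseScalingLimit (criticalCorr 3) ρ S)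
    (hnd : IsNondegenerateTwoPoint S) : Crux ↔ LatticeU4RatioPositive :=
  ⟨fun h => latticeU4RatioPositive_of h hρ hlim hnd, of_latticeU4RatioPositive⟩

/-- **LATTICE TARGET, sequential form (weaker input)**: the same inequality along ONE sequence of meshes
`u_k → 0⁺` (e.g. dyadic scales). -/
def LatticeU4RatioPositiveSeq : Prop :=
  ∃ x ∈ NonCoincident 3 4, ∃ c : ℝ, 0 < c ∧ ∃ u : ℕ → ℝ, Tendsto u atTop (𝓝[>] (0:ℝ)) ∧
    ∀ k, c * (criticalCorr 3 2 ![latticeApprox (u k) (x 0), latticeApprox (u k) (x 1)] *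
      criticalCorr 3 2 ![latticeApprox (u k) (x 2), latticeApprox (u k) (x 3)]) ≤ - latU4 (u k) x

/-- The eventual form implies the sequential form (any sequence `u_k → 0⁺` eventually satisfies it;
take `u_k = (k+2)⁻¹`). [folklore] -/
theorem latticeU4RatioPositiveSeq_of (h : LatticeU4RatioPositive) : LatticeU4RatioPositiveSeq := by
  obtain ⟨x, hx, c, hc, hev⟩ := h
  -- a sequence in `(0,1]` tending to `0⁺`
  have hu : Tendsto (fun k : ℕ => ((k:ℝ) + 2)⁻¹) atTop (𝓝[>] (0:ℝ)) := by
    refine tendsto_nhdsWithin_iff.2 ⟨?_, Filter.Eventually.of_forall fun k => Set.mem_Ioi.2 (by positivity)⟩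
    have h1 : Tendsto (fun k : ℕ => (k:ℝ) + 2) atTop atTop :=
      tendsto_atTop_add_const_right _ _ tendsto_natCast_atTop_atTop
    exact h1.inv_tendsto_atTop
  obtain ⟨N, hN⟩ := eventually_atTop.1 (hu.eventually hev)
  refine ⟨x, hx, c, hc, fun k => ((k + N : ℕ) + 2 : ℝ)⁻¹, ?_, fun k => ?_⟩
  · have : Tendsto (fun k : ℕ => k + N) atTop atTop := tendsto_add_atTop_nat N
    exact hu.comp this
  · exact hN (k + N) (Nat.le_add_left N k)

/-- **§C.1′ — sufficiency of the sequential form**: `LatticeU4RatioPositiveSeq → Crux` (the pointwise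
limit along the full filter restricts to the sequence). [cite: AizenmanDuminilCopinAnnals2021, eq. (3.11)] -/
theorem of_latticeU4RatioPositiveSeq (h : LatticeU4RatioPositiveSeq) : Crux := by
  intro ρ S _ hlim hnd
  obtain ⟨x, hx, c, hc, u, hu, hk⟩ := h
  have hinj : Function.Injective x := hx
  have hpair : ∀ i j, i ≠ j → Tendsto
      (fun δ => ρ δ ^ 2 * criticalCorr 3 2 ![latticeApprox δ (x i), latticeApprox δ (x j)])
      (𝓝[>] 0) (𝓝 (S 2 ![x i, x j])) := by
    intro i j hij
    have hmem : (![x i, x j] : Fin 2 → EuclideanSpace ℝ (Fin 3)) ∈ NonCoincident 3 2 :=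
      pair_mem_nonCoincident fun h => hij (hinj h)
    refine Tendsto.congr (fun δ => ?_) ((hlim 2).tendsto_at hmem)
    rw [rescaledCorrelator_apply, latticeApprox_comp_two]
    rfl
  have hU : Tendsto (fun k => ρ (u k) ^ 4 * latU4 (u k) x) atTop (𝓝 (limitConnectedFour S x)) :=
    (tendsto_rescaled_criticalUrsellFour hlim hx).comp hu
  have hB : Tendsto (fun k => c * ((ρ (u k) ^ 2 *
      criticalCorr 3 2 ![latticeApprox (u k) (x 0), latticeApprox (u k) (x 1)]) * (ρ (u k) ^ 2 *
      criticalCorr 3 2 ![latticeApprox (u k) (x 2), latticeApprox (u k) (x 3)]))) atTop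
      (𝓝 (c * (S 2 ![x 0, x 1] * S 2 ![x 2, x 3]))) :=
    ((((hpair 0 1 (by decide)).mul (hpair 2 3 (by decide))).const_mul c)).comp hu
  have hle : c * (S 2 ![x 0, x 1] * S 2 ![x 2, x 3]) ≤ - limitConnectedFour S x := by
    refine le_of_tendsto_of_tendsto hB hU.neg (Filter.Eventually.of_forall fun k => ?_)
    have h4 : (0:ℝ) ≤ ρ (u k) ^ 4 := by positivity
    have := mul_le_mul_of_nonneg_left (hk k) h4
    calc c * (ρ (u k) ^ 2 * criticalCorr 3 2 ![latticeApprox (u k) (x 0), latticeApprox (u k) (x 1)] *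
          (ρ (u k) ^ 2 * criticalCorr 3 2 ![latticeApprox (u k) (x 2), latticeApprox (u k) (x 3)]))
        = ρ (u k) ^ 4 * (c * (criticalCorr 3 2 ![latticeApprox (u k) (x 0), latticeApprox (u k) (x 1)] *
          criticalCorr 3 2 ![latticeApprox (u k) (x 2), latticeApprox (u k) (x 3)])) := by ring
      _ ≤ ρ (u k) ^ 4 * (- latU4 (u k) x) := this
      _ = -(ρ (u k) ^ 4 * latU4 (u k) x) := by ring
  have h01 : (![x 0, x 1] : Fin 2 → _) ∈ NonCoincident 3 2 :=
    pair_mem_nonCoincident fun h => absurd (hinj h) (by decide)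
  have h23 : (![x 2, x 3] : Fin 2 → _) ∈ NonCoincident 3 2 :=
    pair_mem_nonCoincident fun h => absurd (hinj h) (by decide)
  have hpos : 0 < c * (S 2 ![x 0, x 1] * S 2 ![x 2, x 3]) :=
    mul_pos hc (mul_pos (hnd _ h01) (hnd _ h23))
  exact ⟨x, hx, by linarith⟩

/-- **§C.3′** given existence, all three are equivalent: `Crux ↔ LatticeU4RatioPositive ↔
LatticeU4RatioPositiveSeq`. -/
theorem iff_latticeU4RatioPositiveSeq_of_exists {ρ : ℝ → ℝ} {S : CorrFamily 3}
    (hρ : ∀ δ ∈ Set.Ioc (0:ℝ) 1, 0 < ρ δ) (hlim : HasPointwiseScalingLimit (criticalCorr 3) ρ S)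
    (hnd : IsNondegenerateTwoPoint S) : Crux ↔ LatticeU4RatioPositiveSeq :=
  ⟨fun h => latticeU4RatioPositiveSeq_of (latticeU4RatioPositive_of h hρ hlim hnd),
    of_latticeU4RatioPositiveSeq⟩

/-! ### §C.4 The same target in random-current language (PROVED box identity ADC21 (3.11)) -/

/-- `0 < ⟨σ_aσ_b⟩_{β_c}` on `ℤ³` (lower two-point bound off the diagonal, `= 1` on it). [cite: DuminilCopin2019, Thm. 4.8, §4.4] -/
theorem criticalCorr_two_pos (a b : Site 3) : 0 < criticalCorr 3 2 ![a, b] := by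
  rw [criticalCorr_two_pair]
  by_cases h : b - a = 0
  · rw [h, criticalTwoPoint_zero']
    exact one_pos
  · obtain ⟨c, C, hc, hbd⟩ := criticalTwoPoint_bounds_holds (d := 3) (by norm_num)
    have hn : 0 < (‖b - a‖ : ℝ) := norm_pos_iff.2 h
    exact lt_of_lt_of_le (mul_pos hc (Real.rpow_pos_of_pos hn _)) (hbd _ h).1

/-- The box double-current INTERSECTION PROBABILITY at the mesh-`δ` approximation `yᵢ = [xᵢ/δ]`:
`P^{{y₀}∆{y₁},{y₂}∆{y₃}}_{Λ_L,β_c}[y₀ ↔ y₂]` (trace law of two independent sourced currents in the box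
`Λ_L`, free boundary; `sourcedDoubleCurrentLaw`, event `openConn`). -/
def boxIntersectProb (L : ℕ) (δ : ℝ) (x : Fin 4 → EuclideanSpace ℝ (Fin 3)) : ℝ :=
  (sourcedDoubleCurrentLaw 3 L (criticalBeta 3)
      ({latticeApprox δ (x 0)} ∆ {latticeApprox δ (x 1)})
      ({latticeApprox δ (x 2)} ∆ {latticeApprox δ (x 3)})).real
    (openConn (latticeApprox δ (x 0)) (latticeApprox δ (x 2)))

/-- **RANDOM-CURRENT TARGET**: at one non-coincident quadruple `x` and one `c > 0`, for all small
`δ` and then all large boxes, the double-current clusters of `{[x₀/δ],[x₁/δ]}` and `{[x₂/δ],[x₃/δ]}`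
intersect with probability `≥ c` ("currents are thick in `d = 3`"). -/
def CurrentsIntersectUniformly : Prop :=
  ∃ x ∈ NonCoincident 3 4, ∃ c : ℝ, 0 < c ∧ ∀ᶠ δ in 𝓝[>] (0:ℝ), ∀ᶠ L : ℕ in atTop,
    c ≤ boxIntersectProb L δ x

/-- Box data at `y = [x/δ]`: `U₄,Λ_L → U₄^{lat}`, `⟨σσ⟩_{Λ_L} → ⟨σσ⟩_{β_c}`, and the identity
`U₄,Λ_L = -2⟨σσ⟩⟨σσ⟩·P_L` for `L` large. [cite: AizenmanDuminilCopinAnnals2021, eq. (3.11)] -/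
theorem box_data (δ : ℝ) (x : Fin 4 → EuclideanSpace ℝ (Fin 3)) :
    Tendsto (fun L : ℕ => connectedFour (isingMeasure (zdGraph 3) (box 3 L) (criticalBeta 3) 0 .free)
        spinAt (fun i => latticeApprox δ (x i))) atTop (𝓝 (latU4 δ x)) ∧
    (∀ i j : Fin 4, Tendsto (fun L : ℕ => isingTwoPoint (zdGraph 3) (box 3 L) (criticalBeta 3) 0 .free
        (latticeApprox δ (x i)) (latticeApprox δ (x j))) atTop
        (𝓝 (criticalCorr 3 2 ![latticeApprox δ (x i), latticeApprox δ (x j)]))) ∧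
    ∀ᶠ L : ℕ in atTop,
      connectedFour (isingMeasure (zdGraph 3) (box 3 L) (criticalBeta 3) 0 .free) spinAt
          (fun i => latticeApprox δ (x i)) =
        -2 * isingTwoPoint (zdGraph 3) (box 3 L) (criticalBeta 3) 0 .free
            (latticeApprox δ (x 0)) (latticeApprox δ (x 1)) *
          isingTwoPoint (zdGraph 3) (box 3 L) (criticalBeta 3) 0 .free
            (latticeApprox δ (x 2)) (latticeApprox δ (x 3)) * boxIntersectProb L δ x := by
  classical
  have hmem : (BoundaryCondition.free : BoundaryCondition (Site 3)) ∈
      ({.free, .plus, .minus} : Set (BoundaryCondition (Site 3))) := by simp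
  refine ⟨tendsto_connectedFour_box_criticalBeta le_rfl _, fun i j => ?_, ?_⟩
  · have h := criticalCorr_wellDefined_holds (d := 3) le_rfl 2
      ![latticeApprox δ (x i), latticeApprox δ (x j)] .free hmem
    refine Tendsto.congr (fun L => ?_) h
    simp only [isingTwoPoint, spinMonomial_two]
  · filter_upwards [eventually_forall_mem_box (fun i => latticeApprox δ (x i))] with L hL
    have hy4 : (fun i => latticeApprox δ (x i)) = ![latticeApprox δ (x 0), latticeApprox δ (x 1),
        latticeApprox δ (x 2), latticeApprox δ (x 3)] := by funext i; fin_cases i <;> rfl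
    rw [hy4, connectedFour_free_box_eq (d := 3) L (criticalBeta_nonneg 3) (hL 0) (hL 1) (hL 2) (hL 3)]
    rfl

/-- **§C.4 — sufficiency**: `CurrentsIntersectUniformly → LatticeU4RatioPositive` (with constant `2c`),
hence `→ Crux`. [cite: AizenmanDuminilCopinAnnals2021, eq. (3.11)] -/
theorem latticeU4RatioPositive_of_currentsIntersect (h : CurrentsIntersectUniformly) :
    LatticeU4RatioPositive := by
  obtain ⟨x, hx, c, hc, hev⟩ := h
  refine ⟨x, hx, 2 * c, by positivity, ?_⟩
  filter_upwards [hev] with δ hδ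
  obtain ⟨hU, hG, hid⟩ := box_data δ x
  set G : ℕ → Fin 4 → Fin 4 → ℝ := fun L i j => isingTwoPoint (zdGraph 3) (box 3 L) (criticalBeta 3) 0
    .free (latticeApprox δ (x i)) (latticeApprox δ (x j)) with hGdef
  have hpos01 := criticalCorr_two_pos (latticeApprox δ (x 0)) (latticeApprox δ (x 1))
  have hpos23 := criticalCorr_two_pos (latticeApprox δ (x 2)) (latticeApprox δ (x 3))
  have hlow : Tendsto (fun L => 2 * c * (G L 0 1 * G L 2 3)) atTop
      (𝓝 (2 * c * (criticalCorr 3 2 ![latticeApprox δ (x 0), latticeApprox δ (x 1)] *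
        criticalCorr 3 2 ![latticeApprox δ (x 2), latticeApprox δ (x 3)]))) :=
    ((hG 0 1).mul (hG 2 3)).const_mul _
  refine le_of_tendsto_of_tendsto hlow hU.neg ?_
  filter_upwards [hδ, hid, (hG 0 1).eventually_const_lt hpos01, (hG 2 3).eventually_const_lt hpos23]
    with L hL hidL h01 h23
  rw [hidL]
  have hGG : 0 ≤ G L 0 1 * G L 2 3 := (mul_pos h01 h23).le
  have : 2 * c * (G L 0 1 * G L 2 3) ≤ 2 * boxIntersectProb L δ x * (G L 0 1 * G L 2 3) :=
    mul_le_mul_of_nonneg_right (by linarith) hGG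
  calc 2 * c * (G L 0 1 * G L 2 3) ≤ 2 * boxIntersectProb L δ x * (G L 0 1 * G L 2 3) := this
    _ = -(-2 * G L 0 1 * G L 2 3 * boxIntersectProb L δ x) := by ring

/-- **§C.4′** … hence `CurrentsIntersectUniformly → Crux`. -/
theorem of_currentsIntersect (h : CurrentsIntersectUniformly) : Crux :=
  of_latticeU4RatioPositive (latticeU4RatioPositive_of_currentsIntersect h)

/-- **§C.5 — necessity, given a non-degenerate limit**: `Crux` + existence ⇒ the currents intersect
uniformly (at the quadruple of §C.2, with a quarter of its constant). So, modulo existence of the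
limit, the crux IS "macroscopic double-current clusters in `ℤ³` meet with probability bounded below"
— Aizenman's 1982 criterion, now as a two-sided Lean equivalence. [cite: AizenmanDuminilCopinAnnals2021, eq. (3.11)] [cite: Aizenman1982, §1] -/
theorem currentsIntersect_of (h : Crux) {ρ : ℝ → ℝ} {S : CorrFamily 3}
    (hρ : ∀ δ ∈ Set.Ioc (0:ℝ) 1, 0 < ρ δ) (hlim : HasPointwiseScalingLimit (criticalCorr 3) ρ S)
    (hnd : IsNondegenerateTwoPoint S) : CurrentsIntersectUniformly := by
  obtain ⟨x, hx, c, hc, hev⟩ := latticeU4RatioPositive_of h hρ hlim hnd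
  refine ⟨x, hx, c / 4, by positivity, ?_⟩
  filter_upwards [hev] with δ hδ
  obtain ⟨hU, hG, hid⟩ := box_data δ x
  set G : ℕ → Fin 4 → Fin 4 → ℝ := fun L i j => isingTwoPoint (zdGraph 3) (box 3 L) (criticalBeta 3) 0
    .free (latticeApprox δ (x i)) (latticeApprox δ (x j)) with hGdef
  set g01 := criticalCorr 3 2 ![latticeApprox δ (x 0), latticeApprox δ (x 1)] with hg01
  set g23 := criticalCorr 3 2 ![latticeApprox δ (x 2), latticeApprox δ (x 3)] with hg23
  have hpos01 : 0 < g01 := criticalCorr_two_pos _ _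
  have hpos23 : 0 < g23 := criticalCorr_two_pos _ _
  -- the box intersection probability as a ratio, eventually
  have hPev : ∀ᶠ L : ℕ in atTop, boxIntersectProb L δ x =
      -(connectedFour (isingMeasure (zdGraph 3) (box 3 L) (criticalBeta 3) 0 .free) spinAt
        (fun i => latticeApprox δ (x i))) / (2 * (G L 0 1 * G L 2 3)) := by
    filter_upwards [hid, (hG 0 1).eventually_const_lt hpos01, (hG 2 3).eventually_const_lt hpos23]
      with L hidL h01 h23
    rw [hidL]
    simp only [hGdef]
    field_simp
  have hlimP : Tendsto (fun L : ℕ => -(connectedFour (isingMeasure (zdGraph 3) (box 3 L) (criticalBeta 3) 0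
      .free) spinAt (fun i => latticeApprox δ (x i))) / (2 * (G L 0 1 * G L 2 3))) atTop
      (𝓝 (-(latU4 δ x) / (2 * (g01 * g23)))) :=
    hU.neg.div (((hG 0 1).mul (hG 2 3)).const_mul 2) (by positivity)
  have htarget : c / 4 < -(latU4 δ x) / (2 * (g01 * g23)) := by
    rw [lt_div_iff₀ (by positivity)]
    nlinarith [hδ, mul_pos hpos01 hpos23]
  filter_upwards [hPev, hlimP.eventually_const_lt htarget] with L hPL hlt
  rw [hPL]
  exact hlt.le

/-- **§C.5′** given existence of a non-degenerate limit, `Crux ↔ CurrentsIntersectUniformly`. -/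
theorem iff_currentsIntersect_of_exists {ρ : ℝ → ℝ} {S : CorrFamily 3}
    (hρ : ∀ δ ∈ Set.Ioc (0:ℝ) 1, 0 < ρ δ) (hlim : HasPointwiseScalingLimit (criticalCorr 3) ρ S)
    (hnd : IsNondegenerateTwoPoint S) : Crux ↔ CurrentsIntersectUniformly :=
  ⟨fun h => currentsIntersect_of h hρ hlim hnd, of_currentsIntersect⟩

/-! ## §D Dimension sharpness -/

/-- The crux on `ℤ^d`. -/
def CruxAt (d : ℕ) : Prop :=
  ∀ (ρ : ℝ → ℝ) (S : CorrFamily d), (∀ δ ∈ Set.Ioc (0:ℝ) 1, 0 < ρ δ) →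
    HasPointwiseScalingLimit (criticalCorr d) ρ S → IsNondegenerateTwoPoint S → HasNontrivialU4 S

/-- `CruxAt 3` is the crux. -/
theorem cruxAt_three_iff : CruxAt 3 ↔ Crux := Iff.rfl

/-- **§D.1 — `d ≥ 5`: the same statement holds iff it is VACUOUS.** By the tree theorem
`limitConnectedFour_eq_zero_of_hasPointwiseScalingLimit_holds` (Aizenman 1982 / Fröhlich 1982: every
non-degenerate pointwise limit is Gaussian for `d ≥ 5`), `CruxAt d ↔ ¬∃` non-degenerate limit. So the
crux's truth on `ℤ³` is a `d < 4` phenomenon: a proof must use an input that FAILS in `d ≥ 5` (the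
intersection/tree-diagram count `L^{4-d-2η}`), beyond RP, GKS, Lebowitz, MMS, infrared bounds, which are
dimension-uniform. [cite: Aizenman1982, §1] -/
theorem cruxAt_iff_vacuous_of_five_le {d : ℕ} (hd : 5 ≤ d) :
    CruxAt d ↔ ¬ ∃ (ρ : ℝ → ℝ) (S : CorrFamily d), (∀ δ ∈ Set.Ioc (0:ℝ) 1, 0 < ρ δ) ∧
      HasPointwiseScalingLimit (criticalCorr d) ρ S ∧ IsNondegenerateTwoPoint S := by
  constructor
  · rintro h ⟨ρ, S, hρ, hlim, hnd⟩
    obtain ⟨x, hx, hne⟩ := h ρ S hρ hlim hnd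
    exact hne (limitConnectedFour_eq_zero_of_hasPointwiseScalingLimit_holds hd ρ S hρ hlim hnd x hx)
  · intro h ρ S hρ hlim hnd
    exact absurd ⟨ρ, S, hρ, hlim, hnd⟩ h

/-! ## §E Weak non-degeneracy (gen-1's near-miss, now CLOSED) and open reductions -/

/-- The crux with non-degeneracy at ONE pair only. -/
def CruxWeakNondegeneracy : Prop :=
  ∀ (ρ : ℝ → ℝ) (S : CorrFamily 3), (∀ δ ∈ Set.Ioc (0:ℝ) 1, 0 < ρ δ) →
    HasPointwiseScalingLimit (criticalCorr 3) ρ S → (∃ x₀ ∈ NonCoincident 3 2, 0 < S 2 x₀) →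
      HasNontrivialU4 S

/-- The easy half: weak non-degeneracy version ⇒ crux. -/
theorem of_weakNondegeneracy (h : CruxWeakNondegeneracy) : Crux := fun ρ S hρ hlim hnd =>
  h ρ S hρ hlim ⟨_, refPair_mem, hnd _ refPair_mem⟩

/-- Partial converse: given the crux, a weakly non-degenerate limit has `U₄ ≢ 0` AS SOON AS a fully
non-degenerate limit also exists (uniqueness up to scale at the common positive pair). [folklore] -/
theorem weakNondegeneracy_of_exists (h : Crux) {ρ' : ℝ → ℝ} {S' : CorrFamily 3}
    (hρ' : ∀ δ ∈ Set.Ioc (0:ℝ) 1, 0 < ρ' δ) (hlim' : HasPointwiseScalingLimit (criticalCorr 3) ρ' S')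
    (hnd' : IsNondegenerateTwoPoint S') {ρ : ℝ → ℝ} {S : CorrFamily 3}
    (hρ : ∀ δ ∈ Set.Ioc (0:ℝ) 1, 0 < ρ δ) (hlim : HasPointwiseScalingLimit (criticalCorr 3) ρ S)
    {x₀ : Fin 2 → EuclideanSpace ℝ (Fin 3)} (hx₀ : x₀ ∈ NonCoincident 3 2) (hpos : 0 < S 2 x₀) :
    HasNontrivialU4 S := by
  obtain ⟨c, hc, hscale⟩ := hlim'.exists_scale hρ' hρ hlim hx₀ (hnd' _ hx₀) hpos
  exact (hasNontrivialU4_iff_of_scale hc.ne' hscale).2 (h ρ' S' hρ' hlim' hnd')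

/-- **§E.1 (was gen-1's NEAR-MISS, now a THEOREM)** `Crux ↔ CruxWeakNondegeneracy`: positivity of
`S₂` at ONE pair already gives `IsNondegenerateTwoPoint` for every pointwise limit of `criticalCorr d`
(tree file `PointwiseScalingLimitSelfSimilar`, LANDED p69885 from this seat). No outward doubling bound
on `ℤ³` is needed: the contraction `x ↦ S(μx)` is ANOTHER limit of the same lattice family
(renormalisation `ρ(μδ)`, `HasPointwiseScalingLimit.comp_smul`), positive at the same pair, hence
`S(μ·) = c² S(·)` on pairs (`exists_scale`), while `S(μy) > 0` for `μ` small by MMS inward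
(`two_pos_of_mul_norm_lt`). MORAL for refuters: there is no "half-degenerate" limit to play with —
a limit is either `≡ 0` at order two on all pairs or positive on all pairs. [folklore] -/
theorem iff_weakNondegeneracy : Crux ↔ CruxWeakNondegeneracy := by
  refine ⟨fun h ρ S hρ hlim hx => ?_, of_weakNondegeneracy⟩
  obtain ⟨x₀, hx₀, hpos⟩ := hx
  exact h ρ S hρ hlim (hlim.isNondegenerateTwoPoint_of_two_pos (by norm_num) hρ hx₀ hpos)

/-- **§E.1′ nowhere-or-everywhere alternative** for the two-point function of ANY pointwise limit of
`criticalCorr 3` with `ρ > 0` on `(0,1]`: either `S₂ ≤ 0` at every non-coincident pair (degenerate,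
e.g. the zero family of §A.1; `S₂ ≥ 0` anyway by Griffiths in the limit) or `S₂ > 0` at every pair.
[folklore] -/
theorem two_pos_everywhere_or_nowhere {ρ : ℝ → ℝ} {S : CorrFamily 3}
    (hρ : ∀ δ ∈ Set.Ioc (0:ℝ) 1, 0 < ρ δ) (hlim : HasPointwiseScalingLimit (criticalCorr 3) ρ S) :
    IsNondegenerateTwoPoint S ∨ ∀ x ∈ NonCoincident 3 2, S 2 x ≤ 0 := by
  by_cases h : ∃ x₀ ∈ NonCoincident 3 2, 0 < S 2 x₀
  · obtain ⟨x₀, hx₀, hpos⟩ := h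
    exact Or.inl (hlim.isNondegenerateTwoPoint_of_two_pos (by norm_num) hρ hx₀ hpos)
  · push Not at h
    exact Or.inr h

/-!
### §E.2 OPEN REDUCTION (prose; no OS-reconstruction infrastructure in the tree; `lit` search was
DEGRADED (searchd rc 75) when this was written — citations from memory, to be re-checked)
If a non-degenerate limit `S` of `criticalCorr 3` is Euclidean invariant, scale covariant with
`Δ = 1/2` (i.e. `η = 0`) and satisfies the Osterwalder–Schrader axioms (reflection positivity is the
expected inheritance from `isingTorus_reflectionPositive_*`), then its two-point function is the free
massless one and a Jost–Schroer-type theorem for massless fields (Pohlmeyer, Comm. Math. Phys. 12 (1969)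
204–211, stated in four space-time dimensions; lower-dimensional versions should be checked before use)
would make the reconstructed field FREE: `U₄ ≡ 0`, contradicting the crux. Hence, for OS-positive
limits, `Crux ⇒ η > 0` (equivalently `Δ_σ > 1/2`) modulo that theorem — and `η > 0` is itself OPEN on
`ℤ³` (rigorously `η ≥ 0` from the infrared bound; upper bounds of Duminil-Copin–Panis type).
Conversely for `Δ > 1/2` the Gaussian scenario is the generalised free field of §A.2′ (reflection
positive, Möbius covariant, `U₄ ≡ 0`), which has no local stress tensor — excluded only by
(unformalised) LOCALITY of the Ising limit. So the crux sits exactly between two open problems: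
`η > 0` and "the Ising₃ limit is a local CFT"; neither is weaker than the crux in any proved sense.

### §E.2′ (arithmetic of the locality exclusion) The `σ × σ` OPE of the generalised free field of
dimension `Δ` contains exactly the double-twist families of dimension `2Δ + 2n + ℓ`; a local stress
tensor is a spin-2 operator of dimension exactly `d = 3`, i.e. needs `2Δ + 2n + 2 = 3` for some
`n : ℕ`, impossible for `Δ > 1/2` (`gff_no_stress_tensor_arith` below) and possible only at
`Δ = 1/2, n = 0` — the free field, which is the `η = 0` scenario. So "locality" separates Ising₃ from
the Gaussian scenario exactly when `η > 0`.

### §E.3 WHAT A REFUTATION WOULD HAVE TO BE (census of the negation, all clauses PROVED above)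
`¬Crux` ⇔ there is `(ρ, S)` with: `HasPointwiseScalingLimit (criticalCorr 3) ρ S` along the FULL
filter `δ → 0⁺` for ALL `n` (existence = crux r6 of IsingEuclidUpgrade, open); `S₂ > 0` at one —
hence every (§E.1) — pair; `S_{2n+1} = 0`, `S_{2n} = 𝒢_n[S₂]` on non-coincident configurations
(§B.5); `-2S₂S₂ ≤ U₄ ≡ 0` (§B.1, §B.3); `S₂` inward quasi-monotone (MMS); and — automatically, by
`PointwiseScalingLimitScaleCovariant` (this seat, §B.6) — `S n (c·x) = c^{-nΔ} S n x` with
`Δ ∈ [1/2,1]` (§B.6), i.e. `S₂(x,y) = f(direction)·‖x-y‖^{-2Δ}` with `f` bounded, cubic-symmetric. In words: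
a Gaussian, self-similar, possibly anisotropic massless field with `η ∈ [0,1]` as the full scaling
limit of critical Ising₃. Every known structural property of Ising limits is CONSISTENT with this
object (the GFF of §A.2′ realises all of them with `f ≡` const); only the two open inputs of §E.2 or
the `d < 4` intersection estimate of §C/§D exclude it. This is why the crux resists cheap refutation
AND cheap proof.
-/

/-- **§E.2′** the double-twist arithmetic: no spin-2 dimension-3 operator `2Δ + 2n + 2 = 3` when
`Δ > 1/2`. [folklore] -/
theorem gff_no_stress_tensor_arith {Δ : ℝ} (hΔ : 1/2 < Δ) (n : ℕ) : 2 * Δ + 2 * n + 2 ≠ 3 := by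
  have hn : (0:ℝ) ≤ n := n.cast_nonneg
  intro h
  linarith

/-! ### §E.4 A strengthening REFUTED: continuity of pointwise limits is NOT automatic
(also proposed as Literature `PointwiseScalingLimitNotContinuous`, p71413, review-queued since it has
definitions). Relevance: every informal use of "the limit `S` is continuous / translation invariant /
reflection symmetric" for a pointwise limit of `criticalCorr 3` needs a LATTICE-REGULARITY input
(`⟨…σ_{y+e}…⟩/⟨…σ_y…⟩ → 1` at scale `1/δ`); the definition alone allows jumps across coordinate
hyperplanes, because two points straddling such a hyperplane never share a `δ`-cell of
`latticeApprox`. For THIS crux nothing breaks (all clauses are read at fixed non-coincident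
configurations), but the Gaussian scenario of §E.3 may accordingly have a discontinuous angular
profile `f`, and no refutation/proof may silently assume continuity. -/

/-- A lattice family reading the SIGN of the first coordinate of the first point. -/
def signFamily : LatticeCorrFamily 3 := fun n y =>
  if h : 0 < n then (if 0 ≤ y ⟨0, h⟩ 0 then 1 else 2) else 0

/-- Its exact limit (same step function). -/
def signLimit : CorrFamily 3 := fun n x =>
  if h : 0 < n then (if 0 ≤ x ⟨0, h⟩ 0 then 1 else 2) else 0

/-- `0 ≤ ⌊t/δ⌋ ↔ 0 ≤ t`. -/
theorem floor_div_nonneg_iff {t δ : ℝ} (hδ : 0 < δ) : (0:ℤ) ≤ ⌊t / δ⌋ ↔ 0 ≤ t := by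
  rw [Int.floor_nonneg]
  constructor
  · intro h
    by_contra ht
    push Not at ht
    have : t / δ < 0 := div_neg_of_neg_of_pos ht hδ
    linarith
  · intro ht; positivity

/-- The rescaled correlator of `signFamily` IS `signLimit` at every mesh. -/
theorem rescaled_signFamily_eq {n : ℕ} {δ : ℝ} (hδ : 0 < δ) (x : Fin n → EuclideanSpace ℝ (Fin 3)) :
    rescaledCorrelator signFamily (fun _ => 1) n δ x = signLimit n x := by
  rw [rescaledCorrelator_apply, one_pow, one_mul]
  simp only [signFamily, signLimit, latticeApprox_apply]
  by_cases hn : 0 < n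
  · simp only [dif_pos hn]
    have key : ((0:ℤ) ≤ ⌊x ⟨0, hn⟩ 0 / δ⌋) ↔ 0 ≤ x ⟨0, hn⟩ 0 := floor_div_nonneg_iff hδ
    by_cases h0 : 0 ≤ x ⟨0, hn⟩ 0
    · rw [if_pos h0, if_pos (key.2 h0)]
    · rw [if_neg h0, if_neg (fun h => h0 (key.1 h))]
  · simp only [dif_neg hn]

/-- … hence an exact pointwise scaling limit. -/
theorem hasPointwiseScalingLimit_signFamily :
    HasPointwiseScalingLimit signFamily (fun _ => 1) signLimit := by
  intro n
  refine TendstoUniformlyOn.tendstoLocallyUniformlyOn (Metric.tendstoUniformlyOn_iff.2 fun ε hε => ?_)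
  filter_upwards [self_mem_nhdsWithin] with δ hδ x _
  rw [rescaled_signFamily_eq (Set.mem_Ioi.1 hδ), dist_self]
  exact hε

/-- the limit is NOT continuous on `NonCoincident 3 1` (= everything): it jumps across `{x₀₀ = 0}` -/
theorem not_continuousOn_signLimit : ¬ ContinuousOn (signLimit 1) (NonCoincident 3 1) := by
  intro hc
  set v₀ : EuclideanSpace ℝ (Fin 3) := EuclideanSpace.single (0 : Fin 3) (1:ℝ) with hv₀
  set P : ℝ → (Fin 1 → EuclideanSpace ℝ (Fin 3)) := fun t _ => t • v₀ with hP
  have hPc : Continuous P := continuous_pi fun _ => continuous_id.smul continuous_const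
  have hPmem : ∀ t, P t ∈ NonCoincident 3 1 := fun t => by
    rw [mem_nonCoincident]; intro i j _; exact Subsingleton.elim i j
  have hg : ∀ t, signLimit 1 (P t) = if 0 ≤ t then (1:ℝ) else 2 := by
    intro t
    simp [signLimit, hP, hv₀]
  -- continuity of the composite at `t = 0`
  have hcomp : ContinuousAt (fun t => signLimit 1 (P t)) 0 :=
    (hc.continuousAt ((isOpen_nonCoincident 3 1).mem_nhds (hPmem 0))).comp hPc.continuousAt
  have hnhd : {t : ℝ | signLimit 1 (P t) ∈ Set.Ioo (1/2 : ℝ) (3/2)} ∈ 𝓝 (0:ℝ) := by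
    refine hcomp.preimage_mem_nhds (Ioo_mem_nhds ?_ ?_) <;> rw [hg, if_pos le_rfl] <;> norm_num
  obtain ⟨ε, hε, hball⟩ := Metric.mem_nhds_iff.1 hnhd
  have hmem : (-(ε/2)) ∈ Metric.ball (0:ℝ) ε := by
    rw [Metric.mem_ball, Real.dist_eq, sub_zero, abs_neg, abs_of_pos (by positivity)]; linarith
  have h := hball hmem
  simp only [Set.mem_setOf_eq, hg, if_neg (show ¬ (0:ℝ) ≤ -(ε/2) by push Not; linarith)] at h
  norm_num at h

/-- **Continuity of pointwise scaling limits is NOT automatic**: there is a lattice family with an (exact)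
pointwise scaling limit that is discontinuous on the non-coincident configurations. -/
theorem exists_discontinuous_pointwiseScalingLimit :
    ∃ (G : LatticeCorrFamily 3) (ρ : ℝ → ℝ) (S : CorrFamily 3), (∀ δ, 0 < ρ δ) ∧
      HasPointwiseScalingLimit G ρ S ∧ ¬ ContinuousOn (S 1) (NonCoincident 3 1) :=
  ⟨signFamily, fun _ => 1, signLimit, fun _ => one_pos, hasPointwiseScalingLimit_signFamily,
    not_continuousOn_signLimit⟩


/-! ## §F Numerics (evidence the crux is TRUE, i.e. why it resists)

Queued compute jobs (attached to the item on completion via `--workitem`; the farm was saturated at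
priority 79 when submitted, 2026-08-15T23:36Z): `j007216` (d = 3) and `j007217` (d = 2, 4, 5 controls),
bundle `mcjob/main.py` of this seat's folder — torus Swendsen–Wang at `β_c(3) = 0.221654626`, the
translation/plane-averaged square quadruple `(0, h e_a, h e_b, h(e_a+e_b))`, `h ∈ {L/8, L/4, L/2}`,
`L = 8 … 64`, statistic `p(h,L) := -U₄/(2⟨σσ⟩⟨σσ⟩) ∈ [0,1]` (= the double-current intersection
probability of §C.4 up to the torus/box difference) with jackknife errors, plus the Binder ratio
`⟨m⁴⟩/⟨m²⟩²` as criticality check. READOUT RULE: a Gaussian (crux-violating) limit needs `p(h,L) → 0`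
as `h → ∞` at fixed shape; the crux (with §B.6: `p` is scale-free) predicts a plateau `p → p* > 0`;
`d = 5` must show the `h^{4-d}` decay of the tree-diagram bound (`cruxAt_iff_vacuous_of_five_le`) and
`d = 2` the plateau of a PROVED non-Gaussian limit — the two controls calibrate the readout.

Published numerics already on record: the critical Binder ratio of the 3D Ising class on the periodic
cube, `U₄* = ⟨m⁴⟩/⟨m²⟩² ≈ 1.604` (Hasenbusch, Phys. Rev. B 82 (2010) 174433 = arXiv:1004.4486, p. 10
of the arXiv text, read: "`U_4^* = 1/0.62341(4) = 1.60408(10)` given in [Deng–Blöte]", his own table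
value being sharper), is far from the Gaussian value `3`,
i.e. the block-spin field `T_L` of Aizenman CDM 2020 (7.3)–(7.4) has `R_L = -(⟨T⁴⟩-3⟨T²⟩²) ≈ 1.4`
bounded away from `0` — by Corollary 7.3 there (Gaussian iff `R_L → 0`) this is the numerical face of
the crux; and the conformal-bootstrap spectrum (`Δ_σ ≈ 0.5181`, `Δ_ε ≈ 1.4126`, Kos–Poland–
Simmons-Duffin–Vichi 2016; quoted from memory, `lit` search degraded) is incompatible with the
generalised free field of §A.2′, whose `σ × σ` OPE contains an operator of dimension exactly
`2Δ_σ ≈ 1.036` (§E.2′). None of this is a proof; it is why no refuter should expect the Gaussian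
scenario of §E.3 to be the truth. -/

end Summit.CriticalPhenomena.Ising3DConformalLimit.Cruxes.IsingEuclidUpgradeR4NonGaussian.Disproof

end
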